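import Summits.QuantumAdvantage.QuantumAdvantage.Theorems.SteerDialCylinder

/-!
# SteerDial (5/7): SteerDialStructural

§C.2 — the STRUCTURAL CERTIFICATE THEOREM `wordCert_of_idWord : idWord w = true → wordCert w (cα w) (cβ w) (ca w) (cb
w) = true` for identity words of EVERY length (𝔽₂-linearity of `tstep`; `blockAnd` even and `λ` additive by
telescoping along `p_{k+1} = u_k`, `u_{k+1} = p_k ⊕ w_k u_k`), and the inverse COMPLETION `vinvG` (every word extends
by six letters to an identity word: the transfer maps form the 6-element group `⟨T_0, T_1⟩`,
`word6_closed`/`word6_inv`/`monodromy_mem6` by kernel decision on 64 words).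

Part 5 of 7 of the prover-side twin of the workshop node «SteerDial» (route `SpreadDial`, node on 29065 `CoverLift3`;
lineage decomp-qadv-lens-5, generation 7).  Content verbatim from the monolithic twin `tree/SpreadDialSteer.lean`
(sha256 5f501baf…, farm rc0 · 0 err · 0 warn · 0 sorry; axioms `propext`/`Classical.choice`/`Quot.sound` for every theorem),
cut at section boundaries to meet the 400-line rule.  No `def … : Prop`, no `instance`, no `notation`.
-/

set_option linter.style.longLine false
set_option linter.dupNamespace false

namespace Summit.QuantumAdvantage.QuantumAdvantage.Theorems.SteerDial

open Finset
open Literature.Computability.QuantumComplexity Literature.Computability.MetaComplexity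
open Literature.Computability.QuantumComplexity.RingHLF
open Summit.QuantumAdvantage.AdviceFreeQNC0
open Summit.QuantumAdvantage.QuantumAdvantage.Theses

section StructuralCert
variable {n m : ℕ}

/-- Words of length 6 from their binary code. -/
def wordOfNat (k : ℕ) : Fin 6 → Bool := fun j => Nat.testBit k j.val

/-! ### §C.2 STRUCTURAL CERTIFICATE THEOREM: every identity word of EVERY length carries its canonical certificate

No enumeration: `𝔽₂`-linearity of `tstep` gives the `u`-table; the trajectory recurrence `p_{k+1} = u_k`,
`u_{k+1} = p_k ⊕ w_k u_k` gives `blockAnd` even and `λ` additive by two telescoping identities. -/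

section Structural

/-- ℕ-indexed letters / trajectory components. -/
def wN (w : Fin m → Bool) (k : ℕ) : Bool := if h : k < m then w ⟨k, h⟩ else false
/-- ℕ-indexed second trajectory component `u_k = (iter w k s).2`. -/
def uN (w : Fin m → Bool) (s : St) (k : ℕ) : Bool := (iter w k s).2
/-- ℕ-indexed first trajectory component `p_k = (iter w k s).1`. -/
def pN (w : Fin m → Bool) (s : St) (k : ℕ) : Bool := (iter w k s).1

/-- SteerDial helper `wN_val` (lens-5 g7 SteerDial twin; see the enclosing section docstring). -/
theorem wN_val (w : Fin m → Bool) (j : Fin m) : wN w j.val = w j := by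
  simp [wN, j.isLt]

/-- SteerDial helper `uN_zero` (lens-5 g7 SteerDial twin; see the enclosing section docstring). -/
@[simp] theorem uN_zero (w : Fin m → Bool) (s : St) : uN w s 0 = s.2 := by simp [uN]
/-- SteerDial helper `pN_zero` (lens-5 g7 SteerDial twin; see the enclosing section docstring). -/
@[simp] theorem pN_zero (w : Fin m → Bool) (s : St) : pN w s 0 = s.1 := by simp [pN]

/-- SteerDial helper `pN_succ` (lens-5 g7 SteerDial twin; see the enclosing section docstring). -/
theorem pN_succ (w : Fin m → Bool) (s : St) {k : ℕ} (hk : k < m) : pN w s (k + 1) = uN w s k := by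
  unfold pN uN; exact iter_succ_fst w hk s

/-- SteerDial helper `uN_succ` (lens-5 g7 SteerDial twin; see the enclosing section docstring). -/
theorem uN_succ (w : Fin m → Bool) (s : St) {k : ℕ} (hk : k < m) :
    uN w s (k + 1) = xor (pN w s k) (wN w k && uN w s k) := by
  unfold uN pN wN
  rw [iter_succ w hk, dif_pos hk]
  rfl

/-- SteerDial helper `uN_last` (lens-5 g7 SteerDial twin; see the enclosing section docstring). -/
theorem uN_last (w : Fin m → Bool) (hw : ∀ s : St, monodromy (List.ofFn w) s = s) (s : St) : uN w s m = s.2 := by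
  unfold uN; rw [iter_length, hw s]
/-- SteerDial helper `pN_last` (lens-5 g7 SteerDial twin; see the enclosing section docstring). -/
theorem pN_last (w : Fin m → Bool) (hw : ∀ s : St, monodromy (List.ofFn w) s = s) (s : St) : pN w s m = s.1 := by
  unfold pN; rw [iter_length, hw s]

/-- Componentwise sum on the state space. -/
def stXor (s t : St) : St := (xor s.1 t.1, xor s.2 t.2)

/-- SteerDial helper `tstep_stXor` (lens-5 g7 SteerDial twin; see the enclosing section docstring). -/
theorem tstep_stXor (b : Bool) (s t : St) : tstep b (stXor s t) = stXor (tstep b s) (tstep b t) := by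
  revert b s t; decide

/-- SteerDial helper `iter_stXor` (lens-5 g7 SteerDial twin; see the enclosing section docstring). -/
theorem iter_stXor (w : Fin m → Bool) (s t : St) : ∀ k, k ≤ m → iter w k (stXor s t) = stXor (iter w k s) (iter w k t) := by
  intro k
  induction k with
  | zero => intro _; simp
  | succ k ih =>
    intro hk
    rw [iter_succ w (by omega), iter_succ w (by omega), iter_succ w (by omega), ih (by omega), tstep_stXor]

/-- Linearity of the trajectory in the initial state: the `u`-certificate. -/
theorem kernelVec_linear (w : Fin m → Bool) (s : St) (j : Fin m) :
    kernelVec w s j = ((cα w j && s.1) ^^ (cβ w j && s.2)) := by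
  obtain ⟨p, q⟩ := s
  have h11 : kernelVec w (true, true) j = xor (cα w j) (cβ w j) := by
    have e : ((true, true) : St) = stXor (true, false) (false, true) := by decide
    show (iter w j.val (true, true)).2 = xor (iter w j.val (true, false)).2 (iter w j.val (false, true)).2
    rw [e, iter_stXor w _ _ _ j.isLt.le]
    rfl
  cases p <;> cases q
  · rw [kernelVec_zero]; simp
  · show kernelVec w (false, true) j = _
    simp [cβ]
  · show kernelVec w (true, false) j = _
    simp [cα]
  · rw [h11]; simp

/-- `bnext` is the next trajectory bit (for identity words also at the last position). -/
theorem bnext_eq (w : Fin m → Bool) (hw : ∀ s : St, monodromy (List.ofFn w) s = s) (s : St) (j : Fin m) : bnext w s j = uN w s (j.val + 1) := by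
  unfold bnext
  by_cases h : j.val + 1 < m
  · rw [dif_pos h]; rfl
  · rw [dif_neg h]
    have : j.val + 1 = m := by omega
    rw [this, uN_last w hw]

/-- `blockAnd` as a range sum. -/
theorem blockAnd_eq_sum (w : Fin m → Bool) (s : St) :
    blockAnd w s = ∑ k ∈ range m, (wN w k && uN w s k).toNat := by
  unfold blockAnd
  rw [Finset.card_filter, ← Fin.sum_univ_eq_sum_range (fun k => (wN w k && uN w s k).toNat) m]
  refine Finset.sum_congr rfl (fun j _ => ?_)
  rw [wN_val]
  show _ = (w j && kernelVec w s j).toNat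
  cases w j <;> cases kernelVec w s j <;> simp

/-- `blockEdges` as a range sum (identity words). -/
theorem blockEdges_eq_sum (w : Fin m → Bool) (hw : ∀ s : St, monodromy (List.ofFn w) s = s) (s : St) :
    blockEdges w s = ∑ k ∈ range m, (uN w s k && uN w s (k + 1)).toNat := by
  unfold blockEdges
  rw [Finset.card_filter, ← Fin.sum_univ_eq_sum_range (fun k => (uN w s k && uN w s (k + 1)).toNat) m]
  refine Finset.sum_congr rfl (fun j _ => ?_)
  rw [bnext_eq w hw]
  show _ = (kernelVec w s j && uN w s (j.val + 1)).toNat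
  cases kernelVec w s j <;> cases uN w s (j.val + 1) <;> simp

/-- Bit identity: `[a ⊕ b] + 2[a ∧ b] = [a] + [b]`. -/
theorem toNat_xor_add (a b : Bool) : (xor a b).toNat + 2 * (a && b).toNat = a.toNat + b.toNat := by
  cases a <;> cases b <;> simp

/-- Telescoping parity of two adjacent-shift sums. -/
theorem shift_sum_mod_two (f : ℕ → ℕ) : ∀ m' : ℕ,
    ((∑ k ∈ range m', f (k + 1)) + ∑ k ∈ range m', f k) % 2 = (f 0 + f m') % 2 := by
  intro m'
  induction m' with
  | zero => simp; omega
  | succ m' ih =>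
    rw [Finset.sum_range_succ, Finset.sum_range_succ]
    omega

/-- **`blockAnd` is even on identity words.** -/
theorem blockAnd_even (w : Fin m → Bool) (hw : ∀ s : St, monodromy (List.ofFn w) s = s) (s : St) : blockAnd w s % 2 = 0 := by
  rw [blockAnd_eq_sum]
  -- per-term identity from the recurrence
  have hk : ∀ k ∈ range m, (wN w k && uN w s k).toNat + 2 * (uN w s (k + 1) && pN w s k).toNat =
      (uN w s (k + 1)).toNat + (pN w s k).toNat := by
    intro k hk
    rw [Finset.mem_range] at hk
    have e : (wN w k && uN w s k) = xor (uN w s (k + 1)) (pN w s k) := by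
      rw [uN_succ w s hk]; cases pN w s k <;> cases (wN w k && uN w s k) <;> rfl
    rw [e]; exact toNat_xor_add _ _
  have hsum : (∑ k ∈ range m, (wN w k && uN w s k).toNat) + 2 * ∑ k ∈ range m, (uN w s (k + 1) && pN w s k).toNat =
      (∑ k ∈ range m, (uN w s (k + 1)).toNat) + ∑ k ∈ range m, (pN w s k).toNat := by
    rw [Finset.mul_sum, ← Finset.sum_add_distrib, ← Finset.sum_add_distrib]
    exact Finset.sum_congr rfl hk
  rcases Nat.eq_zero_or_pos m with hm | hm
  · subst hm; simp
  obtain ⟨m', rfl⟩ : ∃ m', m = m' + 1 := ⟨m - 1, by omega⟩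
  have hP : ∑ k ∈ range (m' + 1), (pN w s k).toNat = (s.1).toNat + ∑ k ∈ range m', (uN w s k).toNat := by
    rw [Finset.sum_range_succ']
    rw [pN_zero, add_comm]
    congr 1
    exact Finset.sum_congr rfl (fun k hk => by rw [Finset.mem_range] at hk; rw [pN_succ w s (by omega)])
  have hU : ∑ k ∈ range (m' + 1), (uN w s (k + 1)).toNat = (∑ k ∈ range m', (uN w s (k + 1)).toNat) + (s.2).toNat := by
    rw [Finset.sum_range_succ, uN_last w hw]
  have htel := shift_sum_mod_two (fun k => (uN w s k).toNat) m'
  have hlast : uN w s m' = s.1 := by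
    have := pN_succ w s (show m' < m' + 1 by omega)
    rw [pN_last w hw] at this
    exact this.symm
  simp only [uN_zero, hlast] at htel
  omega

/-- The `λ`-functional `Q(s) = blockEdges + blockAnd/2`: additivity mod 2 at `(1,1) = (1,0) + (0,1)`. -/
theorem lambda_add (w : Fin m → Bool) (hw : ∀ s : St, monodromy (List.ofFn w) s = s) :
    (blockEdges w (true, true) + blockAnd w (true, true) / 2) % 2 =
      ((blockEdges w (true, false) + blockAnd w (true, false) / 2) +
        (blockEdges w (false, true) + blockAnd w (false, true) / 2)) % 2 := by
  -- notation
  set x : ℕ → Bool := uN w (true, false) with hx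
  set y : ℕ → Bool := uN w (false, true) with hy
  set z : ℕ → Bool := uN w (true, true) with hz
  have hzxy : ∀ k, k ≤ m → z k = xor (x k) (y k) := by
    intro k hk
    have e : ((true, true) : St) = stXor (true, false) (false, true) := by decide
    show (iter w k (true, true)).2 = xor (iter w k (true, false)).2 (iter w k (false, true)).2
    rw [e, iter_stXor w _ _ k hk]; rfl
  have hA11 := blockAnd_eq_sum w (true, true)
  have hA10 := blockAnd_eq_sum w (true, false)
  have hA01 := blockAnd_eq_sum w (false, true)
  have hE11 := blockEdges_eq_sum w hw (true, true)
  have hE10 := blockEdges_eq_sum w hw (true, false)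
  have hE01 := blockEdges_eq_sum w hw (false, true)
  have ev11 := blockAnd_even w hw (true, true)
  have ev10 := blockAnd_even w hw (true, false)
  have ev01 := blockAnd_even w hw (false, true)
  -- (ii') A₁₁ + 2D = A₁₀ + A₀₁
  set D := ∑ k ∈ range m, (wN w k && x k && y k).toNat with hD
  have hAdd : blockAnd w (true, true) + 2 * D = blockAnd w (true, false) + blockAnd w (false, true) := by
    rw [hA11, hA10, hA01, hD, Finset.mul_sum, ← Finset.sum_add_distrib, ← Finset.sum_add_distrib]
    refine Finset.sum_congr rfl (fun k hk => ?_)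
    rw [Finset.mem_range] at hk
    show (wN w k && z k).toNat + 2 * (wN w k && x k && y k).toNat = (wN w k && x k).toNat + (wN w k && y k).toNat
    rw [hzxy k hk.le]
    cases wN w k <;> cases x k <;> cases y k <;> simp
  -- (i') E₁₁ ≡ E₁₀ + E₀₁ + C (mod 2)
  set C := ∑ k ∈ range m, ((x k && y (k + 1)).toNat + (y k && x (k + 1)).toNat) with hC
  have hEmod : blockEdges w (true, true) % 2 = (blockEdges w (true, false) + blockEdges w (false, true) + C) % 2 := by
    rw [hE11, hE10, hE01, hC, ← Finset.sum_add_distrib, ← Finset.sum_add_distrib, Finset.sum_nat_mod]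
    conv_rhs => rw [Finset.sum_nat_mod]
    congr 1
    refine Finset.sum_congr rfl (fun k hk => ?_)
    rw [Finset.mem_range] at hk
    show (z k && z (k + 1)).toNat % 2 = ((x k && x (k + 1)).toNat + (y k && y (k + 1)).toNat + ((x k && y (k + 1)).toNat + (y k && x (k + 1)).toNat)) % 2
    rw [hzxy k hk.le, hzxy (k + 1) hk]
    cases x k <;> cases y k <;> cases x (k + 1) <;> cases y (k + 1) <;> simp
  -- (iii') C ≡ D (mod 2)
  have hCD : C % 2 = D % 2 := by
    -- D_k ≡ [x_{k+1} ∧ y_k] + [px_k ∧ y_k]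
    have hDk : ∀ k ∈ range m, (wN w k && x k && y k).toNat % 2 =
        ((x (k + 1) && y k).toNat + (pN w (true, false) k && y k).toNat) % 2 := by
      intro k hk
      rw [Finset.mem_range] at hk
      have e : (wN w k && x k) = xor (x (k + 1)) (pN w (true, false) k) := by
        show (wN w k && uN w (true, false) k) = xor (uN w (true, false) (k + 1)) (pN w (true, false) k)
        rw [uN_succ w _ hk]; cases pN w (true, false) k <;> cases (wN w k && uN w (true, false) k) <;> rfl
      rw [e]
      cases x (k + 1) <;> cases pN w (true, false) k <;> cases y k <;> simp
    have hD2 : D % 2 = ((∑ k ∈ range m, (x (k + 1) && y k).toNat) + ∑ k ∈ range m, (pN w (true, false) k && y k).toNat) % 2 := by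
      rw [hD, Finset.sum_nat_mod, Finset.sum_congr rfl hDk, ← Finset.sum_nat_mod, Finset.sum_add_distrib]
    have hC2 : C = (∑ k ∈ range m, (x k && y (k + 1)).toNat) + ∑ k ∈ range m, (x (k + 1) && y k).toNat := by
      rw [hC, Finset.sum_add_distrib]
      congr 1
      exact Finset.sum_congr rfl (fun k _ => by cases y k <;> cases x (k + 1) <;> rfl)
    -- the shifted sums agree exactly
    have hshift : ∑ k ∈ range m, (x k && y (k + 1)).toNat = ∑ k ∈ range m, (pN w (true, false) k && y k).toNat := by
      rcases Nat.eq_zero_or_pos m with hm | hm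
      · subst hm; simp
      obtain ⟨m', rfl⟩ : ∃ m', m = m' + 1 := ⟨m - 1, by omega⟩
      rw [Finset.sum_range_succ, Finset.sum_range_succ']
      have hxl : x m' = true := by
        have := pN_succ w (true, false) (show m' < m' + 1 by omega)
        rw [pN_last w hw] at this
        exact this.symm
      have hyl : y (m' + 1) = true := uN_last w hw (false, true)
      have hy0 : y 0 = true := uN_zero w (false, true)
      rw [hxl, hyl, pN_zero, hy0]
      congr 1
      exact Finset.sum_congr rfl (fun k hk => by
        rw [Finset.mem_range] at hk; rw [pN_succ w (true, false) (by omega)])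
    rw [hC2, hD2, hshift]
    omega
  omega

/-- **STRUCTURAL CERTIFICATE THEOREM.** Every identity word of every length carries its canonical certificate. -/
theorem wordCert_of_idWord (w : Fin m → Bool) (hw0 : idWord w = true) : wordCert w (cα w) (cβ w) (ca w) (cb w) = true := by
  have hw : ∀ s : St, monodromy (List.ofFn w) s = s := idWord_spec hw0
  unfold wordCert
  rw [decide_eq_true_eq]
  refine ⟨hw, fun s j => kernelVec_linear w s j, fun s => blockAnd_even w hw s, fun s => ?_⟩
  have hca : (if (ca w && s.1) = true then 1 else 0) =
      (if s.1 then (blockEdges w (true, false) + blockAnd w (true, false) / 2) % 2 else 0) := by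
    unfold ca
    cases s.1
    · simp
    · simp only [Bool.and_true, decide_eq_true_eq, if_true]
      rcases Nat.mod_two_eq_zero_or_one (blockEdges w (true, false) + blockAnd w (true, false) / 2) with h | h <;>
        simp [h]
  have hcb : (if (cb w && s.2) = true then 1 else 0) =
      (if s.2 then (blockEdges w (false, true) + blockAnd w (false, true) / 2) % 2 else 0) := by
    unfold cb
    cases s.2
    · simp
    · simp only [Bool.and_true, decide_eq_true_eq, if_true]
      rcases Nat.mod_two_eq_zero_or_one (blockEdges w (false, true) + blockAnd w (false, true) / 2) with h | h <;>
        simp [h]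
  rw [hca, hcb]
  obtain ⟨p, q⟩ := s
  cases p <;> cases q
  · -- s = 0: everything vanishes
    have h0 : blockEdges w (false, false) = 0 ∧ blockAnd w (false, false) = 0 := by
      constructor
      · unfold blockEdges; rw [Finset.card_eq_zero, Finset.filter_eq_empty_iff]; intro j _; rw [kernelVec_zero]; simp
      · unfold blockAnd; rw [Finset.card_eq_zero, Finset.filter_eq_empty_iff]; intro j _; rw [kernelVec_zero]; simp
    simp [h0.1, h0.2]
  · simp
  · simp
  · simp only [if_true]
    rw [lambda_add w hw]; omega

end Structural

/-! ### Completion: every window content extends to an identity word by six letters -/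

section Completion

/-- SteerDial helper `monodromy_append` (lens-5 g7 SteerDial twin; see the enclosing section docstring). -/
theorem monodromy_append (l₁ l₂ : List Bool) (s : St) : monodromy (l₁ ++ l₂) s = monodromy l₂ (monodromy l₁ s) := by
  simp [monodromy, List.foldl_append]

/-- SteerDial helper `monodromy_concat` (lens-5 g7 SteerDial twin; see the enclosing section docstring). -/
theorem monodromy_concat (l : List Bool) (b : Bool) (s : St) : monodromy (l ++ [b]) s = tstep b (monodromy l s) := by
  simp [monodromy, List.foldl_append]

/-- The 64 length-6 words realise a set of transfer maps closed under appending a letter (it is `GL₂(𝔽₂) ≅ S₃`). -/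
theorem word6_closed : ∀ k < 64, ∀ b : Bool, ∃ k' < 64, ∀ s : St,
    tstep b (monodromy (List.ofFn (wordOfNat k)) s) = monodromy (List.ofFn (wordOfNat k')) s := by
  decide +kernel

/-- … and every one of them has an inverse among them. -/
theorem word6_inv : ∀ k < 64, ∃ k' < 64, ∀ s : St,
    monodromy (List.ofFn (wordOfNat k')) (monodromy (List.ofFn (wordOfNat k)) s) = s := by
  decide +kernel

/-- Every word's transfer map is realised by a length-6 word. -/
theorem monodromy_mem6 (l : List Bool) : ∃ k < 64, ∀ s : St, monodromy l s = monodromy (List.ofFn (wordOfNat k)) s := by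
  induction l using List.reverseRecOn with
  | nil => exact ⟨0, by norm_num, by decide⟩
  | append_singleton l b ih =>
    obtain ⟨k, hk, h⟩ := ih
    obtain ⟨k', hk', h'⟩ := word6_closed k hk b
    exact ⟨k', hk', fun s => by rw [monodromy_concat, h s, h' s]⟩

/-- Decidable test "the length-6 word number `k` inverts the transfer map of `c`". -/
def invPred {L : ℕ} (c : Fin L → Bool) (k : ℕ) : Bool :=
  decide (∀ s : St, monodromy (List.ofFn (wordOfNat k)) (monodromy (List.ofFn c) s) = s)

/-- **Inverse completion** of an arbitrary word `c`: the first length-6 word `v` (in binary order) with `T_{c ⧺ v} = 1`. -/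
def vinvG {L : ℕ} (c : Fin L → Bool) : Fin 6 → Bool :=
  wordOfNat (((List.range 64).find? (invPred c)).getD 0)

/-- `c ⧺ vinvG c` is an identity word, for EVERY word `c` of EVERY length. -/
theorem idWord_append_vinvG {L : ℕ} (c : Fin L → Bool) : idWord (Fin.append c (vinvG c)) = true := by
  obtain ⟨k, hk, h⟩ := monodromy_mem6 (List.ofFn c)
  obtain ⟨k', hk', h'⟩ := word6_inv k hk
  have hex : ((List.range 64).find? (invPred c)).isSome = true := by
    rw [List.find?_isSome]
    refine ⟨k', List.mem_range.2 hk', ?_⟩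
    unfold invPred; rw [decide_eq_true_eq]; intro s; rw [h s]; exact h' s
  obtain ⟨k₀, hk₀⟩ := Option.isSome_iff_exists.1 hex
  have hp₀ : invPred c k₀ = true := List.find?_some hk₀
  have hgood : ∀ s : St, monodromy (List.ofFn (wordOfNat k₀)) (monodromy (List.ofFn c) s) = s := by
    unfold invPred at hp₀; rwa [decide_eq_true_eq] at hp₀
  unfold idWord
  rw [decide_eq_true_eq]
  intro s
  rw [List.ofFn_fin_append, monodromy_append]
  unfold vinvG
  rw [hk₀]
  exact hgood s

/-- Hence every word extended by its inverse completion carries the canonical certificate. -/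
theorem wordCert_append_vinvG {L : ℕ} (c : Fin L → Bool) :
    wordCert (Fin.append c (vinvG c)) (cα (Fin.append c (vinvG c))) (cβ (Fin.append c (vinvG c)))
      (ca (Fin.append c (vinvG c))) (cb (Fin.append c (vinvG c))) = true :=
  wordCert_of_idWord _ (idWord_append_vinvG c)

end Completion

end StructuralCert

end Summit.QuantumAdvantage.QuantumAdvantage.Theorems.SteerDial
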